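import Literature.MathematicalPhysics.QuantumFieldTheory.Balaban1983to89.B12Ineq417DeltaB

/-!
# `Balaban1983to89.B7LocalityGeneral` — [Balaban1985Averaging] p. 24 / p. 31: LOCALITY of the averaging operations AT A GENERAL
BACKGROUND on `ℤ^d` — the twisted transports (58), block frames (62)/(82), (65), the double-bar average (89), the one-step map (121)
and the composite `Q_j(U₀, B)` (127) depend, jointly in the background and the field, only on the bond variables in
`B^j(c₋) ∪ B^j(c₊)` — PROVED; whence the CHART input of [Balaban1987RG1] (4.17) at a general background (`B12Ineq417General`,
`B12Ineq417DeltaB`) is discharged at every background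

HONEST FRAMING (cell `lit-balaban`, verbatim): statement-level skeleton of published theorems with citation tags; proofs where
landed; nothing here is a claim about the Yang–Mills mass gap.

CITATION HEADER.  T. Bałaban, *Averaging operations for lattice gauge theories*, Commun. Math. Phys. **98** (1985) 17–51
[Balaban1985Averaging] (cell paper B7; journal page = PDF page + 16): p. 24 (after (43)) «this definition is local in the sense that
Ū^k_c, c ⊂ Ω^{(k)}, depends only on the bond variables U_b for b ⊂ B^k(c₋) ∪ B^k(c₊). This property will play a very important role in
the future», p. 31 (after (91)) the operations (89)–(91) «have the same locality properties», p. 34 «(V̿₁)_c is an analytic function of the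
variables A_b, b ⊂ B(c₋) ∪ B(c₊)», (58) p. 27, (62) p. 28, (65) p. 29, (82) p. 30, (89) p. 31, (121) p. 36, (127) p. 37; T. Bałaban,
*Renormalization group approach to lattice gauge field theories. I*, Commun. Math. Phys. **109** (1987) 249–301 [Balaban1987RG1]
(cell paper B12), (4.17) p. 285, (4.6) p. 282.  Unit `lit-balaban-r20` gen 4; B7 SUPPLEMENT (owner r04; the flat/one-step locality of
record is b07's `B7Prop1Local` — `bavg_congr`, `avgIter_congr`, `hol_treeWord_congr` — and `B7Prop5Flat` — `dbavg_congr`,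
`logIter_congr`, `inBox_nest`, `agreeOn_insCfg_restr` —, all REUSED here, nothing restated); third instalment of the NE9 owner's
NEED-3 (a).

WHAT THIS FILE PROVES (kernel, 0 sorry, standard axioms; no definitions, no `def … : Prop`):
* §1 `agreeOn_mul`, `tHol_treeWord_congr` (58), `Fcov_congr` (62)/(82), `wframe_congr`, `tild_congr` (65), `dbavgCov_congr` (89),
  `Qcov_congr` (121) — two pairs (background, field) agreeing on the bonds of `B(c₋) ∪ B(c₊)` give the same value at the `L`-bond `c`.
* §2 **`logCovIter_congr`** (127): `Q_j(U₀, B)(c)` depends only on `U₀|_{B^j(c₋)∪B^j(c₊)}` and `B|_{B^j(c₋)∪B^j(c₊)}`; `logCovIter_eq_chart`: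
  `Q_{j,μ}(U₀, F)(z) = Q_{j,μ}(U₀, ins(F|_S))(z)`, `S = boxBonds L j z μ` — the CHART through the finite product `𝔸^S` at ANY background.
* §3 `ineq417_general_local`, `ineq417_deltaB_general_local`: `B12Ineq417General.ineq417_general` and
  `B12Ineq417DeltaB.ineq417_deltaB_general` with the chart hypothesis DISCHARGED — the inputs left at a general background `U₀` are the
  analyticity and the size of `q ↦ Q_{j,μ}(tU₀, ins q)(z)` on the sup-norm ball (Proposition 4 of [7] at the background `tU₀`) and the
  background-variation bound.

DIVERGENCES / NOT PROVED.  `ℤ^d`, no torus (cf. `B7AvgPeriodicity` for the descent); the box `B^j(c₋) ∪ B^j(c₊)` is b07's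
`[L^jz, L^jz + (L^j − 1)𝟙 + L^je_κ]` (`loK`/`bondHiK`); Proposition 4 of [7] at a general background is NOT discharged here (the tree's
`B7Prop4GeneralLevels`/`B7Prop4GeneralInduction` carry one-step inputs as hypotheses).
-/

noncomputable section

open scoped BigOperators
open Set Metric
open Literature.MathematicalPhysics.QuantumFieldTheory.Balaban1983to89
open Literature.MathematicalPhysics.QuantumFieldTheory.Balaban1983to89.B7Prop1Explicit (e hol treeWord boxVec bavg)
open Literature.MathematicalPhysics.QuantumFieldTheory.Balaban1983to89.B7Prop1Local (InBox AgreeOn bondHi loK bondHiK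
  hol_treeWord_congr bavg_congr avgIter_congr add_zsmul_e_apply add_e_apply)
open Literature.MathematicalPhysics.QuantumFieldTheory.Balaban1983to89.B7Prop2Explicit (avgIter)
open Literature.MathematicalPhysics.QuantumFieldTheory.Balaban1983to89.B7Prop3Flat (insCfg expCfg)
open Literature.MathematicalPhysics.QuantumFieldTheory.Balaban1983to89.B7Prop5Flat (BondIn inBox_nest agreeOn_expCfg bondsIn restr
  agreeOn_insCfg_restr)
open Literature.MathematicalPhysics.QuantumFieldTheory.Balaban1983to89.B7Eq92Concrete (Rc tHol Fcov wframe tild dbavgCov)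
open Literature.MathematicalPhysics.QuantumFieldTheory.Balaban1983to89.B7Prop3GeneralLinear (Qcov)
open Literature.MathematicalPhysics.QuantumFieldTheory.Balaban1983to89.B7Prop4GeneralLevels (logCovIter logCovIter_succ)
open Literature.MathematicalPhysics.QuantumFieldTheory.Balaban1983to89.B12Ineq417Flat (shiftCfg boxBonds)
open Literature.MathematicalPhysics.QuantumFieldTheory.Balaban1983to89.B7TranslationCovariance (dlocBG)
open Literature.MathematicalPhysics.QuantumFieldTheory.Balaban1983to89.B12Ineq417General (ineq417_general)
open Literature.MathematicalPhysics.QuantumFieldTheory.Balaban1983to89.B12Ineq417DeltaB (dQ ineq417_deltaB_general)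

namespace Literature.MathematicalPhysics.QuantumFieldTheory.Balaban1983to89.B7LocalityGeneral

variable {d : ℕ}

/-! ## §1 One step at a general background -/

section Group

variable {G : Type*} [Group G] {lo hi : B7Prop1Explicit.Site d}

/-- Agreement on a box is preserved by pointwise products. [cite: Balaban1985Averaging, p.24] (elementary API; our proof) -/
theorem agreeOn_mul {V V' W W' : B7Prop1Explicit.Site d → Fin d → G} (hV : AgreeOn lo hi V V') (hW : AgreeOn lo hi W W') :
    AgreeOn lo hi (V * W) (V' * W') := fun x κ hx hx' => by
  simp only [Pi.mul_apply, hV x κ hx hx', hW x κ hx hx']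

/-- **Locality of the twisted transport (58)** `(R_{0,p}V₁)(Γ_{p,p+v})` along a tree contour inside the box: it depends only on the
bond variables of `V₀` and `V₁` in the box. [cite: Balaban1985Averaging, (58) p.27, p.24] -/
theorem tHol_treeWord_congr {V₀ V₀' V₁ V₁' : B7Prop1Explicit.Site d → Fin d → G} (h₀ : AgreeOn lo hi V₀ V₀')
    (h₁ : AgreeOn lo hi V₁ V₁') (p v : B7Prop1Explicit.Site d) (hp : InBox lo hi p) (hpv : InBox lo hi (p + v)) :
    tHol V₀ V₁ p (treeWord v) = tHol V₀' V₁' p (treeWord v) := by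
  unfold tHol
  rw [hol_treeWord_congr (agreeOn_mul h₁ h₀) p v hp hpv, hol_treeWord_congr h₀ p v hp hpv]

end Group

section OneStep

variable {𝔸 : Type*} [NormedRing 𝔸] [NormedAlgebra ℂ 𝔸] [CompleteSpace 𝔸]
variable {lo hi : B7Prop1Explicit.Site d} {V₀ V₀' V₁ V₁' : B7Prop1Explicit.Site d → Fin d → 𝔸ˣ}

omit [CompleteSpace 𝔸] in
/-- **Locality of the block-frame exponent (62)/(82)** `F(y) = Σ_{x∈B(y)} L^{−d} log (R_{0,y}V₁)(Γ_{y,x})`: bonds of the block `B(y)`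
(of any box containing it). [cite: Balaban1985Averaging, (62) p.28, (82) p.30, p.31] -/
theorem Fcov_congr (L : ℕ) (h₀ : AgreeOn lo hi V₀ V₀') (h₁ : AgreeOn lo hi V₁ V₁') (q : B7Prop1Explicit.Site d)
    (hq : InBox lo hi q) (hqL : ∀ i, q i + ((L : ℤ) - 1) ≤ hi i) : Fcov L V₀ V₁ q = Fcov L V₀' V₁' q := by
  unfold Fcov
  refine Finset.sum_congr rfl fun r _ => ?_
  have hr : ∀ i, 0 ≤ boxVec L r i ∧ boxVec L r i + 1 ≤ L := fun i =>
    ⟨by simp [boxVec], by have := (r i).isLt; simp only [boxVec]; omega⟩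
  rw [tHol_treeWord_congr h₀ h₁ q (boxVec L r) hq fun i => ?_]
  have := hr i; have := hq i; have := hqL i
  simp only [Pi.add_apply]
  constructor <;> omega

/-- **Locality of the block frame (82)** `\overline{R_{0,y}V₁} = exp F(y)`. [cite: Balaban1985Averaging, (82) p.30, p.31] -/
theorem wframe_congr (L : ℕ) (h₀ : AgreeOn lo hi V₀ V₀') (h₁ : AgreeOn lo hi V₁ V₁') (q : B7Prop1Explicit.Site d)
    (hq : InBox lo hi q) (hqL : ∀ i, q i + ((L : ℤ) - 1) ≤ hi i) : wframe L V₀ V₁ q = wframe L V₀' V₁' q := by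
  unfold wframe
  rw [Fcov_congr L h₀ h₁ q hq hqL]

/-- **Locality of (65)** `Ṽ₁(c) = (\overline{V₁V₀})_c(V̄₀)_c⁻¹`: bonds of `B(c₋) ∪ B(c₊)`. [cite: Balaban1985Averaging, (65) p.29, p.24] -/
theorem tild_congr (L : ℕ) (hL : 1 ≤ L) (q : B7Prop1Explicit.Site d) (κ : Fin d)
    (h₀ : AgreeOn q (bondHi L q κ) V₀ V₀') (h₁ : AgreeOn q (bondHi L q κ) V₁ V₁') :
    tild L V₀ V₁ q κ = tild L V₀' V₁' q κ := by
  simp only [B7Eq92Concrete.tild_apply]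
  rw [bavg_congr L hL q κ (agreeOn_mul h₁ h₀), bavg_congr L hL q κ h₀]

/-- **LOCALITY OF THE DOUBLE-BAR AVERAGE (89) AT A GENERAL BACKGROUND** (p. 31: «the same locality properties» as (42)/(43)): two
pairs `(V₀, V₁)`, `(V₀′, V₁′)` agreeing on the bonds of `B(c₋) ∪ B(c₊) = [q, q + (L−1)𝟙 + Le_κ]` give the same `V̿₁(c)`, `c = ⟨q, q + Le_κ⟩`.
[cite: Balaban1985Averaging, (89) p.31, p.24] -/
theorem dbavgCov_congr (L : ℕ) (hL : 1 ≤ L) (q : B7Prop1Explicit.Site d) (κ : Fin d)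
    (h₀ : AgreeOn q (bondHi L q κ) V₀ V₀') (h₁ : AgreeOn q (bondHi L q κ) V₁ V₁') :
    dbavgCov L V₀ V₁ q κ = dbavgCov L V₀' V₁' q κ := by
  have hq : InBox q (bondHi L q κ) q := fun i => by
    simp only [bondHi]; split_ifs <;> omega
  have hqL : InBox q (bondHi L q κ) (q + (L : ℤ) • e κ) := fun i => by
    simp only [bondHi, add_zsmul_e_apply]; split_ifs <;> omega
  have h1 : ∀ i, q i + ((L : ℤ) - 1) ≤ bondHi L q κ i := fun i => by
    simp only [bondHi]; split_ifs <;> omega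
  have h2 : ∀ i, (q + (L : ℤ) • e κ) i + ((L : ℤ) - 1) ≤ bondHi L q κ i := fun i => by
    simp only [bondHi, add_zsmul_e_apply]; split_ifs <;> omega
  rw [B7Eq92Concrete.dbavgCov_apply, B7Eq92Concrete.dbavgCov_apply, wframe_congr L h₀ h₁ q hq h1,
    wframe_congr L h₀ h₁ _ hqL h2, tild_congr L hL q κ h₀ h₁, bavg_congr L hL q κ h₀]

/-- **Locality of the one-step map (121)** `Q(V₀, A, c)`, jointly in `(V₀, A)`: bonds of `B(c₋) ∪ B(c₊)` (p. 34: «an analytic function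
of the variables A_b, b ⊂ B(c₋) ∪ B(c₊)»). [cite: Balaban1985Averaging, (121) p.36, p.34, p.24] -/
theorem Qcov_congr (L : ℕ) (hL : 1 ≤ L) (q : B7Prop1Explicit.Site d) (κ : Fin d)
    {A A' : B7Prop1Explicit.Site d → Fin d → 𝔸} (h₀ : AgreeOn q (bondHi L q κ) V₀ V₀') (hA : AgreeOn q (bondHi L q κ) A A') :
    Qcov L V₀ A q κ = Qcov L V₀' A' q κ := by
  unfold Qcov
  rw [dbavgCov_congr L hL q κ h₀ (agreeOn_expCfg hA)]

end OneStep

/-! ## §2 The composite `Q_j(U₀, B)` (127) -/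

section Composite

variable {𝔸 : Type*} [NormedRing 𝔸] [NormedAlgebra ℂ 𝔸] [CompleteSpace 𝔸]

/-- **LOCALITY OF THE COMPOSITE AVERAGING (127) AT A GENERAL BACKGROUND**: `Q_j(U₀, B)(c)`, `c = ⟨z, z + e_κ⟩` of the `j`-th lattice,
depends only on the bond variables of `U₀` AND of `B` in `B^j(c₋) ∪ B^j(c₊) = [L^jz, L^jz + (L^j − 1)𝟙 + L^je_κ]` (p. 24 / p. 31; the flat
case is `B7Prop5Flat.logIter_congr`). [cite: Balaban1985Averaging, (127) p.37, p.24 (after (43)), p.31 (after (91))] -/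
theorem logCovIter_congr (L : ℕ) (hL : 1 ≤ L) :
    ∀ (j : ℕ) {U₀ U₀' : B7Prop1Explicit.Site d → Fin d → 𝔸ˣ} {B B' : B7Prop1Explicit.Site d → Fin d → 𝔸}
      (z : B7Prop1Explicit.Site d) (κ : Fin d),
      AgreeOn (loK L j z) (bondHiK L j z κ) U₀ U₀' → AgreeOn (loK L j z) (bondHiK L j z κ) B B' →
        logCovIter L U₀ B j z κ = logCovIter L U₀' B' j z κ
  | 0, U₀, U₀', B, B', z, κ, _, h => by
    refine h z κ (fun i => ?_) (fun i => ?_)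
    · simp only [loK, bondHiK, pow_zero, one_mul]; split_ifs <;> omega
    · simp only [loK, bondHiK, pow_zero, one_mul, add_e_apply]; split_ifs <;> omega
  | j + 1, U₀, U₀', B, B', z, κ, h₀, h => by
    rw [logCovIter_succ, logCovIter_succ]
    refine Qcov_congr L hL _ κ (fun x μ hx hxe => ?_) (fun x μ hx hxe => ?_)
    · exact avgIter_congr L hL j x μ fun p ν hp hpν =>
        h₀ p ν (inBox_nest L j z κ ⟨hx, hxe⟩ hp) (inBox_nest L j z κ ⟨hx, hxe⟩ hpν)
    · exact logCovIter_congr L hL j x μ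
        (fun p ν hp hpν => h₀ p ν (inBox_nest L j z κ ⟨hx, hxe⟩ hp) (inBox_nest L j z κ ⟨hx, hxe⟩ hpν))
        (fun p ν hp hpν => h p ν (inBox_nest L j z κ ⟨hx, hxe⟩ hp) (inBox_nest L j z κ ⟨hx, hxe⟩ hpν))

/-- **THE CHART AT ANY BACKGROUND**: `Q_{j,μ}(U₀, F)(z) = Q_{j,μ}(U₀, ins(F|_S))(z)` with `S = boxBonds L j z μ` the bonds of
`B^j(c₋) ∪ B^j(c₊)` — `Q_{j,μ}(U₀, ·)(z)` factors through the finite product `𝔸^S` (the flat case is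
`B12Ineq417Flat.logIter_eq_avgMap_restr`). [cite: Balaban1985Averaging, (127) p.37, p.34; Balaban1987RG1, (4.17) p.285] -/
theorem logCovIter_eq_chart (L : ℕ) (hL : 1 ≤ L) (U₀ : B7Prop1Explicit.Site d → Fin d → 𝔸ˣ)
    (F : B7Prop1Explicit.Site d → Fin d → 𝔸) (j : ℕ) (z : B7Prop1Explicit.Site d) (μ : Fin d) :
    logCovIter L U₀ F j z μ = logCovIter L U₀ (insCfg (boxBonds L j z μ) (restr (boxBonds L j z μ) F)) j z μ :=
  logCovIter_congr L hL j z μ (fun _ _ _ _ => rfl) (agreeOn_insCfg_restr (loK L j z) (bondHiK L j z μ) F)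

end Composite

/-! ## §3 [Balaban1987RG1] (4.17) at a general background with the chart discharged -/

section Ineq417

variable {𝔸 : Type*} [NormedRing 𝔸] [NormedAlgebra ℂ 𝔸] [CompleteSpace 𝔸]

/-- **(4.17) AT A GENERAL BACKGROUND, CHART DISCHARGED** (`B12Ineq417General.ineq417_general` + `logCovIter_eq_chart`): with
`t = t_{L^je_ν}`, `S = boxBonds L j z μ`, `φ(q) = Q_{j,μ}(tU₀, ins q)(z)`, the inputs are: `φ` holomorphic on the sup-norm ball of radius
`b₁` and bounded by `M` there (Proposition 4 of [7] at the background `tU₀`), the size `M₀` of `Q_{j,μ}(U₀, B)(z + e_ν)`, the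
background-variation bound `ε_bg`, and the data bounds; conclusion `‖(∂_νB_μ)(z)‖ ≤ δM₀ + |ζ̃(z)|(M·L^jg/ρ + ε_bg)`.
[cite: Balaban1987RG1, (4.17) p.285; Balaban1985Averaging, Prop. 4 p.38, (127) p.37, p.24] -/
theorem ineq417_general_local (ζ : B7Prop1Explicit.Site d → ℝ) (L : ℕ) (hL : 1 ≤ L)
    (U₀ : B7Prop1Explicit.Site d → Fin d → 𝔸ˣ) (B : B7Prop1Explicit.Site d → Fin d → 𝔸) (j : ℕ) (ν : Fin d)
    (z : B7Prop1Explicit.Site d) (μ : Fin d) {b b₁ M M₀ g ρ εbg δ : ℝ}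
    (hφ : DifferentiableOn ℂ (fun q : boxBonds L j z μ → 𝔸 =>
      logCovIter L (shiftCfg (((L : ℤ) ^ j) • e ν) U₀) (insCfg (boxBonds L j z μ) q) j z μ) (ball 0 b₁))
    (hM0 : 0 ≤ M) (hM : ∀ q ∈ ball (0 : boxBonds L j z μ → 𝔸) b₁,
      ‖logCovIter L (shiftCfg (((L : ℤ) ^ j) • e ν) U₀) (insCfg (boxBonds L j z μ) q) j z μ‖ ≤ M)
    (hb : 0 ≤ b) (hB : ∀ x κ, ‖B x κ‖ ≤ b) (hg0 : 0 ≤ g) (hg : ∀ x κ, ‖B (x + e ν) κ - B x κ‖ ≤ g)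
    (hρ : 0 < ρ) (hroom : b + (L : ℝ) ^ j * g + ρ ≤ b₁)
    (hQ : ‖logCovIter L U₀ B j (z + e ν) μ‖ ≤ M₀)
    (hbg : ‖logCovIter L (shiftCfg (((L : ℤ) ^ j) • e ν) U₀) B j z μ - logCovIter L U₀ B j z μ‖ ≤ εbg)
    (hζ : |ζ (z + e ν) - ζ z| ≤ δ) :
    ‖dlocBG ζ L U₀ B j ν z μ‖ ≤ δ * M₀ + |ζ z| * (M * ((L : ℝ) ^ j * g) / ρ + εbg) :=
  ineq417_general ζ L U₀ B j ν z μ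
    (fun q : boxBonds L j z μ → 𝔸 => logCovIter L (shiftCfg (((L : ℤ) ^ j) • e ν) U₀) (insCfg (boxBonds L j z μ) q) j z μ)
    (fun F => logCovIter_eq_chart L hL _ F j z μ) hφ hM0 hM hb hB hg0 hg hρ hroom hQ hbg hζ

/-- **(4.17) FOR `δB` AT A GENERAL BACKGROUND, CHART DISCHARGED** (`B12Ineq417DeltaB.ineq417_deltaB_general` + `logCovIter_eq_chart`):
inputs = analyticity and size of `φ(q) = Q_{j,μ}(tU₀, ins q)(z)` on the sup-norm ball (Proposition 4 of [7] at `tU₀`), the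
background-variation bound for `δQ`, and the data bounds. [cite: Balaban1987RG1, (4.17) p.285, (4.6) p.282; Balaban1985Averaging, Prop. 4 p.38, (127) p.37] -/
theorem ineq417_deltaB_general_local (L : ℕ) (hL : 1 ≤ L) (U₀ : B7Prop1Explicit.Site d → Fin d → 𝔸ˣ)
    (F W : B7Prop1Explicit.Site d → Fin d → 𝔸) (j : ℕ) (ν : Fin d) (z : B7Prop1Explicit.Site d) (μ : Fin d)
    {b b₁ M g gW ω ρ εbg : ℝ}
    (hφ : AnalyticOnNhd ℂ (fun q : boxBonds L j z μ → 𝔸 =>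
      logCovIter L (shiftCfg (((L : ℤ) ^ j) • e ν) U₀) (insCfg (boxBonds L j z μ) q) j z μ) (ball 0 b₁))
    (hM0 : 0 ≤ M) (hM : ∀ q ∈ ball (0 : boxBonds L j z μ → 𝔸) b₁,
      ‖logCovIter L (shiftCfg (((L : ℤ) ^ j) • e ν) U₀) (insCfg (boxBonds L j z μ) q) j z μ‖ ≤ M)
    (hb : 0 ≤ b) (hF : ∀ x κ, ‖F x κ‖ ≤ b) (hg0 : 0 ≤ g) (hg : ∀ x κ, ‖F (x + e ν) κ - F x κ‖ ≤ g)
    (hω : 0 ≤ ω) (hW : ∀ x κ, ‖W x κ‖ ≤ ω) (hgW0 : 0 ≤ gW) (hgW : ∀ x κ, ‖W (x + e ν) κ - W x κ‖ ≤ gW)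
    (hρ : 0 < ρ) (hroom : b + (L : ℝ) ^ j * g + 2 * ρ ≤ b₁)
    (hbg : ‖dQ L (shiftCfg (((L : ℤ) ^ j) • e ν) U₀) F W j z μ - dQ L U₀ F W j z μ‖ ≤ εbg) :
    ‖dQ L U₀ F W j (z + e ν) μ - dQ L U₀ F W j z μ‖
      ≤ M * ((L : ℝ) ^ j * gW) / ρ + M * ω * ((L : ℝ) ^ j * g) / ρ ^ 2 + εbg :=
  ineq417_deltaB_general L U₀ F W j ν z μ
    (fun q : boxBonds L j z μ → 𝔸 => logCovIter L (shiftCfg (((L : ℤ) ^ j) • e ν) U₀) (insCfg (boxBonds L j z μ) q) j z μ)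
    (fun G => logCovIter_eq_chart L hL _ G j z μ) hφ hM0 hM hb hF hg0 hg hω hW hgW0 hgW hρ hroom hbg

end Ineq417

end Literature.MathematicalPhysics.QuantumFieldTheory.Balaban1983to89.B7LocalityGeneral

end
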